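import Literature.NumberTheory.ComplexMultiplication.FiniteQAlgebraLatticeMetricDual
import Mathlib.LinearAlgebra.Dual.Lemmas
import Mathlib.RingTheory.Artinian.Ring
import Mathlib.RingTheory.LocalRing.MaximalIdeal.Basic
import Mathlib.Algebra.TrivSqZeroExt.Basic
import HarnessLib

/-!
# WHICH LINEAR FORMS `l : A → ℚ` GIVE A MULTIPLICATIVE METRIC `φ(a, b) = l(ab)` on a finite-dimensional commutative
# `ℚ`-algebra: `φ` is nondegenerate iff `ker l` contains no non-zero ideal; for a LOCAL `A`, iff `l` sees every
# non-zero socle element, and — when the socle is cyclic — iff `l(socle) ≠ 0` (Hertling–Larabi 2026b Rem. 3.4 (i));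
# a metric forces `dim_ℚ socle ≤ dim_ℚ A/𝔪` (the socle is `1`-dimensional over the residue field); the square-zero
# algebras `ℚ1 ⊕ M` carry a metric iff `dim M ≤ 1` (Rem. 3.4 (v): `ℚ[x,y]/(x,y)²` is not Gorenstein)

[topic NumberTheory/ComplexMultiplication] General-`A` series (namespace
`Literature.NumberTheory.ComplexMultiplication.FiniteQAlgebraLattice`); sequel of `FiniteQAlgebraLatticeMetricDual`
(§1 there: Def. 3.3 (b), the form `(LinearMap.mul ℚ A).compr₂ l` = `(a, b) ↦ l(ab)` of (3.2), `isSymm_of_map_mul`,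
`eq_compr₂_apply_one`, `compr₂_mul_map_mul`; Rem. 3.4 (ii) for cyclic `A`: `nondegenerate_compr₂_coord_last` — REUSED
by name, not restated).  This file supplies what `FiniteQAlgebraLatticeMetricDual` lists as NOT there: «Remark 3.4
(i)'s socle criterion for WHICH `l` give metrics».  Lane `lit-hodgefound` (Track 2 foundations library), seat p19
generation 37, row g37-#6.  THEOREMS ONLY: no definition, no instance, no notation, no named fact (D-0026, net
Literature debt `0`), no `sorry`.

SPELLING.  «`A` is Gorenstein» is not a Mathlib notion; following HL it is replaced by its consequence∕criterion «`A`
carries a multiplicative metric» = `∃ l, ((LinearMap.mul ℚ A).compr₂ l).Nondegenerate`, and for a LOCAL `A` (one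
factor `A^{(j)}` of Thm. 3.1) the socle `Ann_A(N)` is `(IsLocalRing.maximalIdeal A).annihilator`; «the socle is a
`1`-dimensional `F`-vector space» is used in the two forms «the socle is a cyclic ideal `A·s₀`» (sufficiency) and
«`dim_ℚ Ann(𝔪) ≤ dim_ℚ A/𝔪`» (necessity; `dim_ℚ = dim_F · [F : ℚ]`).

## Source, VERBATIM

C. Hertling, K. Larabi, *Conjugacy classes of regular integer matrices*, arXiv:2602.15748 (2026) [HertlingLarabi2026b],
held `paper:arxiv-2602.15748`, §3 (chunk p0006) — `A` «a finite dimensional commutative ℚ-algebra with unit element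
`1_A`», `A = ⊕_j A^{(j)}`, `A^{(j)} = F^{(j)} ⊕ N^{(j)}` local with residue field `F^{(j)}` (Thm. 3.1):
«**Definition 3.3.** […] (b) A symmetric ℚ-bilinear form `Φ : A × A → ℚ` is multiplication invariant if
`Φ(ab, c) = Φ(a, bc)` for `a, b, c ∈ A`. A symmetric ℚ-bilinear form which is multiplication invariant and
nondegenerate is called multiplicative metric. If `A` has a multiplicative metric then `A` is a Gorenstein ring.
**Remarks 3.4.** […] (i) It is well known and easy to see that `A` is a Gorenstein ring if and only if for each
`j ∈ {1, ..., k}` the socle `Ann_{A^{(j)}}(N^{(j)}) ⊂ A^{(j)}` of `A^{(j)}` is a 1-dimensional vector space over `F^{(j)}`.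
In that case any ℚ-linear form `l : A → ℚ` with `Ann_{A^{(j)}}(N^{(j)}) ⊄ ker(l)` for `j ∈ {1, ..., k}` gives rise to
a multiplicative metric via `φ(a, b) := l(ab)` (3.2), and any multiplicative metric is constructed in this way.
(ii) Any cyclic algebra is Gorenstein. […] (iv) The algebra `A = ℚ[x,y]/(x², y²)` is Gorenstein, but not cyclic.
(v) The algebra `A = ℚ[x,y]/(x², xy, y²)` is not Gorenstein (so also not cyclic), as it is irreducible with
2-dimensional socle.»

## What is proved (`l : A →ₗ[ℚ] ℚ`, `φ_l := (LinearMap.mul ℚ A).compr₂ l`)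

* §1 (any commutative `ℚ`-algebra) `isRefl_compr₂_mul`; **`nondegenerate_compr₂_mul_iff`** (`φ_l` nondegenerate iff
  `l(aA) = 0 ⟹ a = 0`) and **`nondegenerate_compr₂_mul_iff_forall_ideal`** (iff `ker l` contains no ideal `≠ 0`).
* §2 (LOCAL, Artinian — e.g. finite-dimensional — `A`, socle `Ann(𝔪)`): `exists_mem_ne_zero_mul_maximalIdeal_eq_zero`
  (every non-zero ideal contains a non-zero socle element), **`nondegenerate_compr₂_mul_iff_socle`** (`φ_l`
  nondegenerate iff `l(sA) ≠ 0` for every socle element `s ≠ 0`), REMARK 3.4 (i) for a cyclic socle `A·s₀`: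
  **`nondegenerate_compr₂_mul_iff_exists_of_socle_cyclic`** (`φ_l` nondegenerate iff `l(s₀b) ≠ 0` for some `b`, i.e.
  `Ann(𝔪) ⊄ ker l`), and the necessity of a small socle **`finrank_annihilator_add_finrank_maximalIdeal_le`**
  (a metric forces `dim_ℚ Ann(𝔪) + dim_ℚ 𝔪 ≤ dim_ℚ A`, i.e. `dim_ℚ Ann(𝔪) ≤ dim_ℚ A/𝔪`).
* §3 REMARK 3.4 (v) and its converse for the square-zero algebras `A = TrivSqZeroExt ℚ M = ℚ1 ⊕ M` (`M·M = 0`;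
  `M = ℚ²` is `ℚ[x,y]/(x², xy, y²)`): `trivSqZeroExt_inr_mul_eq_smul`, **`exists_nondegenerate_compr₂_mul_iff_finrank_le_one`**
  (`ℚ1 ⊕ M` has a multiplicative metric iff `dim M ≤ 1`).
NOT here: the global form of Rem. 3.4 (i) over the product decomposition `A = ⊕_j A^{(j)}` (Thm. 3.1), Rem. 3.4
(iv) (`ℚ[x,y]/(x²,y²)`), (vi).

## References
* [HertlingLarabi2026b] C. Hertling, K. Larabi, arXiv:2602.15748 (2026), §3 Def. 3.3 (b), Rem. 3.4 (i), (ii), (iv), (v)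
  (chunk p0006). [cite: HertlingLarabi2026b, §3 Rem. 3.4 (i) and (v), chunk p0006]
* [HertlingLarabi2026] C. Hertling, K. Larabi, arXiv:2602.14973 (2026), §3 Thm. 3.1, Lemma 3.3 (socle filtration
  `S_1 = Ann(R)`). [cite: HertlingLarabi2026, §3 Thm. 3.1 and Lemma 3.3, chunks p0007–p0008]
-/

noncomputable section

open Module

namespace Literature.NumberTheory.ComplexMultiplication.FiniteQAlgebraLattice

section MetricCriterion

variable {A : Type} [CommRing A] [Algebra ℚ A]

/-! ## §1 `φ_l(a, b) = l(ab)` is nondegenerate iff `ker l` contains no non-zero ideal -/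

/-- `φ_l(a, b) = l(ab)` is reflexive (indeed symmetric: `FiniteQAlgebraLatticeMetricDual.isSymm_of_map_mul`).
[cite: HertlingLarabi2026b, §3 Def. 3.3 (b) and Rem. 3.4 (i) (3.2), chunk p0006] -/
theorem isRefl_compr₂_mul (l : A →ₗ[ℚ] ℚ) : LinearMap.IsRefl ((LinearMap.mul ℚ A).compr₂ l) := fun x y h => by
  rw [LinearMap.compr₂_apply, LinearMap.mul_apply'] at h ⊢
  rwa [mul_comm]

/-- **`φ_l` is NONDEGENERATE iff `l(aA) = 0` forces `a = 0`** (a symmetric form is nondegenerate iff it is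
left-separating). [cite: HertlingLarabi2026b, §3 Def. 3.3 (b) and Rem. 3.4 (i), chunk p0006] -/
theorem nondegenerate_compr₂_mul_iff (l : A →ₗ[ℚ] ℚ) :
    ((LinearMap.mul ℚ A).compr₂ l).Nondegenerate ↔ ∀ a : A, (∀ b : A, l (a * b) = 0) → a = 0 := by
  rw [(isRefl_compr₂_mul l).nondegenerate_iff_separatingLeft]
  simp only [LinearMap.SeparatingLeft, LinearMap.compr₂_apply, LinearMap.mul_apply']

/-- **REMARK 3.4 (i), ideal form: `φ_l` is nondegenerate iff NO NON-ZERO IDEAL of `A` lies in `ker l`** (the radical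
of `φ_l`, `{a | l(aA) = 0}`, is the largest ideal inside `ker l`). [cite: HertlingLarabi2026b, §3 Rem. 3.4 (i), chunk p0006] -/
theorem nondegenerate_compr₂_mul_iff_forall_ideal (l : A →ₗ[ℚ] ℚ) :
    ((LinearMap.mul ℚ A).compr₂ l).Nondegenerate ↔ ∀ I : Ideal A, (∀ x ∈ I, l x = 0) → I = ⊥ := by
  rw [nondegenerate_compr₂_mul_iff]
  constructor
  · intro h I hI
    rw [eq_bot_iff]
    intro a ha
    rw [Submodule.mem_bot]
    exact h a fun b => hI _ (I.mul_mem_right b ha)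
  · intro h a ha
    have h1 := h (Ideal.span {a}) fun x hx => by
      obtain ⟨c, rfl⟩ := Ideal.mem_span_singleton'.1 hx
      rw [mul_comm]; exact ha c
    exact Ideal.span_singleton_eq_bot.1 h1

/-! ## §2 Local `A`: the socle criterion (Remark 3.4 (i)) -/

section Local

variable [IsLocalRing A]

omit [Algebra ℚ A] in
/-- **In a local Artinian ring every non-zero ideal contains a non-zero SOCLE element** (`𝔪` is nilpotent; for the
least `k` with `I𝔪^k = 0`, any `s ∈ I𝔪^{k−1} ∖ 0` has `s𝔪 = 0`) — why only the socle matters in Rem. 3.4 (i).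
[cite: HertlingLarabi2026, §3 Lemma 3.3 (the socle `S_1 = Ann(R)` and the socle filtration), chunk p0008] [cite: HertlingLarabi2026b, §3 Rem. 3.4 (i), chunk p0006] -/
theorem exists_mem_ne_zero_mul_maximalIdeal_eq_zero [IsArtinianRing A] {I : Ideal A} (hI : I ≠ ⊥) :
    ∃ s ∈ I, s ≠ 0 ∧ ∀ m ∈ IsLocalRing.maximalIdeal A, s * m = 0 := by
  classical
  have hnil : IsNilpotent (IsLocalRing.maximalIdeal A) := by
    have h := IsArtinianRing.isNilpotent_jacobson_bot (R := A)
    rwa [IsLocalRing.jacobson_eq_maximalIdeal ⊥ bot_ne_top] at h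
  obtain ⟨n, hn⟩ := hnil
  have hex : ∃ k : ℕ, I * IsLocalRing.maximalIdeal A ^ k = ⊥ := ⟨n, by rw [hn, mul_zero, Submodule.zero_eq_bot]⟩
  have hk : I * IsLocalRing.maximalIdeal A ^ Nat.find hex = ⊥ := Nat.find_spec hex
  have hk0 : Nat.find hex ≠ 0 := fun h0 => hI (by rw [h0, pow_zero, mul_one] at hk; exact hk)
  have hJ : I * IsLocalRing.maximalIdeal A ^ (Nat.find hex - 1) ≠ ⊥ :=
    Nat.find_min hex (by omega)
  obtain ⟨s, hsJ, hs0⟩ := Submodule.exists_mem_ne_zero_of_ne_bot hJ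
  refine ⟨s, Ideal.mul_le_right hsJ, hs0, fun m hm => ?_⟩
  have hsm : s * m ∈ I * IsLocalRing.maximalIdeal A ^ Nat.find hex := by
    have e : Nat.find hex = (Nat.find hex - 1) + 1 := by omega
    rw [e, pow_succ, ← mul_assoc]
    exact Ideal.mul_mem_mul hsJ hm
  rw [hk] at hsm
  exact (Submodule.mem_bot A).1 hsm

/-- **REMARK 3.4 (i), socle form: on a local Artinian `A`, `φ_l` is nondegenerate iff `l(sA) ≠ 0` for every
non-zero socle element `s` (`s𝔪 = 0`).** [cite: HertlingLarabi2026b, §3 Rem. 3.4 (i), chunk p0006] -/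
theorem nondegenerate_compr₂_mul_iff_socle [IsArtinianRing A] (l : A →ₗ[ℚ] ℚ) :
    ((LinearMap.mul ℚ A).compr₂ l).Nondegenerate ↔
      ∀ s : A, (∀ m ∈ IsLocalRing.maximalIdeal A, s * m = 0) → s ≠ 0 → ∃ b : A, l (s * b) ≠ 0 := by
  constructor
  · rw [nondegenerate_compr₂_mul_iff]
    intro h s _ hs0
    by_contra hne
    simp only [not_exists, not_not] at hne
    exact hs0 (h s hne)
  · rw [nondegenerate_compr₂_mul_iff_forall_ideal]
    intro h I hI
    by_contra hne
    obtain ⟨s, hsI, hs0, hsm⟩ := exists_mem_ne_zero_mul_maximalIdeal_eq_zero hne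
    obtain ⟨b, hb⟩ := h s hsm hs0
    exact hb (hI _ (I.mul_mem_right b hsI))

/-- **REMARK 3.4 (i) AS PRINTED, for a local `A` whose socle is CYCLIC, `Ann(𝔪) = A·s₀` («a 1-dimensional vector space
over `F`»): `φ_l(a, b) = l(ab)` is a multiplicative metric iff `Ann(𝔪) ⊄ ker l`, i.e. iff `l(s₀b) ≠ 0` for some `b`**
(every non-zero socle element is `u·s₀` with `u` a unit). [cite: HertlingLarabi2026b, §3 Rem. 3.4 (i), chunk p0006] -/
theorem nondegenerate_compr₂_mul_iff_exists_of_socle_cyclic [IsArtinianRing A] {s₀ : A}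
    (hs₀ : ∀ m ∈ IsLocalRing.maximalIdeal A, s₀ * m = 0)
    (hcyc : ∀ s : A, (∀ m ∈ IsLocalRing.maximalIdeal A, s * m = 0) → ∃ a : A, s = a * s₀) (l : A →ₗ[ℚ] ℚ) :
    ((LinearMap.mul ℚ A).compr₂ l).Nondegenerate ↔ ∃ b : A, l (s₀ * b) ≠ 0 := by
  rw [nondegenerate_compr₂_mul_iff_socle]
  constructor
  · intro h
    by_cases h0 : s₀ = 0
    · -- then the socle vanishes, impossible in a non-zero local Artinian ring
      obtain ⟨s, -, hs0, hsm⟩ := exists_mem_ne_zero_mul_maximalIdeal_eq_zero (A := A) (I := ⊤) top_ne_bot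
      obtain ⟨a, rfl⟩ := hcyc s hsm
      exact (hs0 (by rw [h0, mul_zero])).elim
    · exact h s₀ hs₀ h0
  · rintro ⟨b, hb⟩ s hsm hs0
    obtain ⟨a, rfl⟩ := hcyc s hsm
    have ha : IsUnit a := by
      by_contra hna
      exact hs0 (by rw [mul_comm]; exact hs₀ a ((IsLocalRing.mem_maximalIdeal a).2 hna))
    obtain ⟨u, rfl⟩ := ha
    refine ⟨(↑u⁻¹ : A) * b, ?_⟩
    rwa [mul_comm (u : A) s₀, mul_assoc, Units.mul_inv_cancel_left]

omit [IsLocalRing A] in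
/-- `φ_l(s, ·)` vanishes on `𝔪` for a socle element `s` (file-local). [folklore] -/
private theorem compr₂_mul_apply_eq_zero_of_mem {l : A →ₗ[ℚ] ℚ} {𝔪 : Ideal A} {s : A}
    (hs : ∀ m ∈ 𝔪, s * m = 0) {m : A} (hm : m ∈ 𝔪) : (LinearMap.mul ℚ A).compr₂ l s m = 0 := by
  rw [LinearMap.compr₂_apply, LinearMap.mul_apply', hs m hm, map_zero]

/-- **REMARK 3.4 (i), NECESSITY of a small socle: if a local finite-dimensional `A` carries a multiplicative metric
`φ_l`, then `dim_ℚ Ann(𝔪) + dim_ℚ 𝔪 ≤ dim_ℚ A`, i.e. `dim_ℚ Ann(𝔪) ≤ dim_ℚ A/𝔪 = [F : ℚ]` — the socle is at most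
(`A ≠ 0`: exactly) `1`-dimensional over the residue field `F`** («`A` is a Gorenstein ring if and only if […] the
socle […] is a 1-dimensional vector space over `F^{(j)}`»: `s ↦ φ_l(s, ·)` embeds `Ann(𝔪)` into the forms vanishing
on `𝔪`). [cite: HertlingLarabi2026b, §3 Rem. 3.4 (i) («irreducible with 2-dimensional socle» ⟹ not Gorenstein, Rem. 3.4 (v)), chunk p0006] -/
theorem finrank_annihilator_add_finrank_maximalIdeal_le [Module.Finite ℚ A] (l : A →ₗ[ℚ] ℚ)
    (hnd : ((LinearMap.mul ℚ A).compr₂ l).Nondegenerate) :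
    finrank ℚ ((IsLocalRing.maximalIdeal A).annihilator.restrictScalars ℚ) +
        finrank ℚ ((IsLocalRing.maximalIdeal A).restrictScalars ℚ) ≤ finrank ℚ A := by
  set Soc : Submodule ℚ A := (IsLocalRing.maximalIdeal A).annihilator.restrictScalars ℚ with hSoc
  set M : Submodule ℚ A := (IsLocalRing.maximalIdeal A).restrictScalars ℚ with hM
  -- `Ψ : Soc → A^*`, `s ↦ φ_l(s, ·)`, injective with image in the annihilator of `𝔪`
  let Ψ : Soc →ₗ[ℚ] Module.Dual ℚ A := ((LinearMap.mul ℚ A).compr₂ l).domRestrict Soc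
  have hΨinj : Function.Injective Ψ := by
    rw [← LinearMap.ker_eq_bot, eq_bot_iff]
    intro s hs
    rw [LinearMap.mem_ker] at hs
    rw [Submodule.mem_bot, Subtype.ext_iff, Submodule.coe_zero]
    refine (nondegenerate_compr₂_mul_iff l).1 hnd s fun b => ?_
    have h := LinearMap.congr_fun hs b
    rwa [LinearMap.domRestrict_apply, LinearMap.compr₂_apply, LinearMap.mul_apply', LinearMap.zero_apply] at h
  have hΨle : LinearMap.range Ψ ≤ M.dualAnnihilator := by
    rintro _ ⟨s, rfl⟩
    rw [Submodule.mem_dualAnnihilator]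
    intro m hm
    rw [LinearMap.domRestrict_apply]
    have hs : ∀ m ∈ IsLocalRing.maximalIdeal A, (s : A) * m = 0 := fun m hm => by
      have h := (Submodule.mem_annihilator.1 (show (s : A) ∈ (IsLocalRing.maximalIdeal A).annihilator from s.2)) m hm
      rwa [smul_eq_mul] at h
    exact compr₂_mul_apply_eq_zero_of_mem hs hm
  have h1 : finrank ℚ Soc = finrank ℚ (LinearMap.range Ψ) := (LinearMap.finrank_range_of_inj hΨinj).symm
  have h2 : finrank ℚ (LinearMap.range Ψ) ≤ finrank ℚ M.dualAnnihilator := Submodule.finrank_mono hΨle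
  have h3 := Subspace.finrank_add_finrank_dualAnnihilator_eq M
  omega

end Local

/-! ## §3 Remark 3.4 (v) and its converse: `ℚ1 ⊕ M`, `M·M = 0`, has a metric iff `dim M ≤ 1` -/

section TrivSqZeroExt

variable {M : Type} [AddCommGroup M] [Module ℚ M] [Module ℚᵐᵒᵖ M] [IsCentralScalar ℚ M]

/-- In `ℚ1 ⊕ M`: `(0, m)·b = b_0·(0, m)`. [cite: HertlingLarabi2026b, §3 Rem. 3.4 (v) («`a² = ab = b² = 0`» of Lemma 12.1), chunk p0006] -/
theorem trivSqZeroExt_inr_mul_eq_smul (m : M) (b : TrivSqZeroExt ℚ M) :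
    (TrivSqZeroExt.inr m : TrivSqZeroExt ℚ M) * b = b.fst • (TrivSqZeroExt.inr m : TrivSqZeroExt ℚ M) := by
  refine TrivSqZeroExt.ext ?_ ?_
  · simp
  · rw [TrivSqZeroExt.snd_mul, TrivSqZeroExt.snd_smul, TrivSqZeroExt.fst_inr, TrivSqZeroExt.snd_inr, zero_smul,
      zero_add, op_smul_eq_smul]

/-- **REMARK 3.4 (v) generalised, with converse: the square-zero algebra `A = ℚ1 ⊕ M` (`M·M = 0`, `dim M < ∞`)
carries a multiplicative metric iff `dim_ℚ M ≤ 1`** — for `M = ℚ²` this is «`ℚ[x,y]/(x², xy, y²)` is not Gorenstein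
(so also not cyclic), as it is irreducible with 2-dimensional socle»; for `M = ℚ` (`ℚ[x]/(x²)`, cyclic) and `M = 0`
the metric is `l = fst + ψ∘snd` with `ψ(v) = 1` on a generator `v`.  («⇒»: `m ↦ l(0, m)` is injective, since
`l((0,m)·b) = b_0·l(0,m)`.) [cite: HertlingLarabi2026b, §3 Rem. 3.4 (i), (v), chunk p0006] -/
theorem exists_nondegenerate_compr₂_mul_iff_finrank_le_one [Module.Finite ℚ M] :
    (∃ l : TrivSqZeroExt ℚ M →ₗ[ℚ] ℚ, ((LinearMap.mul ℚ (TrivSqZeroExt ℚ M)).compr₂ l).Nondegenerate) ↔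
      finrank ℚ M ≤ 1 := by
  constructor
  · rintro ⟨l, hl⟩
    rw [nondegenerate_compr₂_mul_iff] at hl
    -- `m ↦ l(inr m)` is injective
    have hinj : Function.Injective (l ∘ₗ TrivSqZeroExt.inrHom ℚ M) := by
      rw [← LinearMap.ker_eq_bot, eq_bot_iff]
      intro m hm
      rw [LinearMap.mem_ker, LinearMap.comp_apply] at hm
      rw [Submodule.mem_bot]
      have h0 : (TrivSqZeroExt.inr m : TrivSqZeroExt ℚ M) = 0 := hl _ fun b => by
        rw [trivSqZeroExt_inr_mul_eq_smul, map_smul, smul_eq_mul]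
        exact mul_eq_zero_of_right _ hm
      simpa using congrArg TrivSqZeroExt.snd h0
    have h := LinearMap.finrank_le_finrank_of_injective hinj
    rwa [Module.finrank_self] at h
  · intro h
    obtain ⟨v, hv⟩ := finrank_le_one_iff.1 h
    -- a functional `ψ` with `ψ v = 1` (if `v ≠ 0`), resp. `ψ = 0`
    have hψ : ∃ ψ : M →ₗ[ℚ] ℚ, ∀ c : ℚ, ψ (c • v) = c ∨ v = 0 := by
      by_cases hv0 : v = 0
      · exact ⟨0, fun c => Or.inr hv0⟩
      · obtain ⟨μ, hμ⟩ := not_forall.1 (mt (Module.forall_dual_apply_eq_zero_iff ℚ v).1 hv0)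
        refine ⟨(μ v)⁻¹ • μ, fun c => Or.inl ?_⟩
        rw [LinearMap.smul_apply, map_smul, smul_eq_mul, smul_eq_mul, ← mul_assoc, mul_comm (μ v)⁻¹ c, mul_assoc,
          inv_mul_cancel₀ hμ, mul_one]
    obtain ⟨ψ, hψ⟩ := hψ
    refine ⟨(TrivSqZeroExt.fstHom ℚ ℚ M).toLinearMap + ψ ∘ₗ TrivSqZeroExt.sndHom ℚ M, ?_⟩
    rw [nondegenerate_compr₂_mul_iff]
    intro x hx
    -- test against `inr v`: `x·(0,v) = (0, x_0 v)`, so `x_0·ψ(v) = 0`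
    have h1 := hx (TrivSqZeroExt.inr v)
    have h2 := hx 1
    rw [mul_one] at h2
    obtain ⟨c, hc⟩ := hv x.snd
    rcases hψ x.fst with hfst | hv0
    · -- `v ≠ 0` branch not needed explicitly: use the formula
      rw [mul_comm, trivSqZeroExt_inr_mul_eq_smul] at h1
      simp only [map_smul, LinearMap.add_apply, AlgHom.toLinearMap_apply, TrivSqZeroExt.fstHom_apply,
        TrivSqZeroExt.fst_inr, LinearMap.comp_apply, TrivSqZeroExt.sndHom_apply, TrivSqZeroExt.snd_inr,
        zero_add, smul_eq_mul] at h1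
      -- `h1 : x.fst * ψ v = 0`; with `ψ (x.fst • v) = x.fst`:
      have hx0 : x.fst = 0 := by
        have e : ψ (x.fst • v) = x.fst * ψ v := by rw [map_smul, smul_eq_mul]
        rw [← hfst, e, h1]
      simp only [LinearMap.add_apply, AlgHom.toLinearMap_apply, TrivSqZeroExt.fstHom_apply, LinearMap.comp_apply,
        TrivSqZeroExt.sndHom_apply, hx0, zero_add] at h2
      -- `h2 : ψ x.snd = 0`, `x.snd = c • v`, `ψ (c • v) = c` or `v = 0`
      have hsnd : x.snd = 0 := by
        rcases hψ c with hc' | hv0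
        · rw [← hc, hc'] at h2; rw [← hc, h2, zero_smul]
        · rw [← hc, hv0, smul_zero]
      exact TrivSqZeroExt.ext hx0 hsnd
    · -- `v = 0`: `M = 0`, `x.snd = c • 0 = 0`, and `h2 : x.fst + ψ 0 = 0`
      have hsnd : x.snd = 0 := by rw [← hc, hv0, smul_zero]
      simp only [LinearMap.add_apply, AlgHom.toLinearMap_apply, TrivSqZeroExt.fstHom_apply, LinearMap.comp_apply,
        TrivSqZeroExt.sndHom_apply, hsnd, map_zero, add_zero] at h2
      exact TrivSqZeroExt.ext h2 hsnd

end TrivSqZeroExt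

end MetricCriterion

end Literature.NumberTheory.ComplexMultiplication.FiniteQAlgebraLattice
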